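import Mathlib
import Literature.NumberTheory.Sieve.RoughOmegaCellsAsymptoticDensity
import Literature.NumberTheory.Sieve.RoughDivisorPowerSums
import Literature.NumberTheory.LFunctions.MertensFormula
import Summits.Parity.GeneralizedHardyLittlewood.Theorems.ParityLeakOneFifthPlainSplitCalibTools
import Summits.Parity.GeneralizedHardyLittlewood.Theorems.ParityLeakOneFifthPlainSplitTwistedRemainderSum
import HarnessLib

/-!
# Route ParityLeakOneFifth, crux `ParityLeakSieve` (stmt-Parity-18381), skeleton `birth`:
# analytic tools for the corner count of stub S2

* `Vsh_le_two_mul_V`: `V_sh(z) = ∏_{2<p<z}(1 − 1/(p−1)) ≤ 2V(z)`, `V(z) = ∏_{p<z}(1 − 1/p)`;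
* `exists_card_cellTwo_le`: the `Ω = 2` cell of the `Y`-rough integers up to `X` has at most
  `C·X/log Y` elements (`e ≤ Y ≤ X`, `log X ≤ 3 log Y`; Alladi's asymptotic with `I₂(u) ≤ u ≤ 3`);
* `sum_inv_primes_window_le`: Mertens' second theorem in a window, two-sided rate:
  `Σ_{A<p≤B} 1/p ≤ log log B − log log A + 8/log A + 8/log B`;
* `exists_sum_inv_cornerDivisors_le`: for the semiprime `x^{1/5}`-rough `d` with
  `x^{1/2−2ε} < d`, `d² ≤ 2x+2`: `Σ 1/d ≤ C(ε + 1/log x)` (`0 < ε ≤ 1/50`, `x` large).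
-/

namespace Summit.Parity.GeneralizedHardyLittlewood.Theorems.ParityLeakOneFifth

open Finset Real
open scoped ArithmeticFunction.Omega
open Literature.NumberTheory.Sieve
open Literature.NumberTheory.LFunctions

/-! ### `V_sh ≤ 2V` -/

/-- `V_sh(z) ≤ 2 V(z)` for `z > 2` (termwise `1 − 1/(p−1) ≤ 1 − 1/p` at the odd primes, and the
factor `1/2` of `V` at `p = 2`). -/
theorem Vsh_le_two_mul_V {z : ℝ} (hz : 2 < z) :
    ∏ p ∈ (Finset.range ⌈z⌉₊).filter (fun p : ℕ => p.Prime ∧ p ≠ 2), (1 - 1 / ((p : ℝ) - 1)) ≤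
      2 * ∏ p ∈ (Finset.range ⌈z⌉₊).filter Nat.Prime, (1 - 1 / (p : ℝ)) := by
  set S := (Finset.range ⌈z⌉₊).filter (fun p : ℕ => p.Prime ∧ p ≠ 2) with hS
  have h2 : 2 ∈ (Finset.range ⌈z⌉₊).filter Nat.Prime :=
    Finset.mem_filter.2 ⟨Finset.mem_range.2 (Nat.lt_ceil.2 (by exact_mod_cast hz)), Nat.prime_two⟩
  have hdecomp : (Finset.range ⌈z⌉₊).filter Nat.Prime = insert 2 S := by
    ext p
    simp only [hS, Finset.mem_insert, Finset.mem_filter, Finset.mem_range]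
    constructor
    · rintro ⟨hp, hpr⟩
      by_cases h : p = 2
      · exact Or.inl h
      · exact Or.inr ⟨hp, hpr, h⟩
    · rintro (rfl | ⟨hp, hpr, -⟩)
      · exact ⟨(Finset.mem_filter.1 h2).1 |> Finset.mem_range.1, Nat.prime_two⟩
      · exact ⟨hp, hpr⟩
  have h2S : 2 ∉ S := by simp [hS]
  rw [hdecomp, Finset.prod_insert h2S]
  have hS3 : ∀ p ∈ S, 3 ≤ p := by
    intro p hp
    obtain ⟨-, hpr, hne⟩ := Finset.mem_filter.1 hp
    have := hpr.two_le; omega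
  have hle : ∏ p ∈ S, (1 - 1 / ((p : ℝ) - 1)) ≤ ∏ p ∈ S, (1 - 1 / (p : ℝ)) := by
    refine Finset.prod_le_prod (fun p hp => ?_) (fun p hp => ?_)
    · have h3 : (3 : ℝ) ≤ p := by exact_mod_cast hS3 p hp
      rw [sub_nonneg, div_le_one (by linarith)]; linarith
    · have h3 : (3 : ℝ) ≤ p := by exact_mod_cast hS3 p hp
      have : 1 / (p : ℝ) ≤ 1 / ((p : ℝ) - 1) :=
        one_div_le_one_div_of_le (by linarith) (by linarith)
      linarith
  calc ∏ p ∈ S, (1 - 1 / ((p : ℝ) - 1)) ≤ ∏ p ∈ S, (1 - 1 / (p : ℝ)) := hle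
    _ = 2 * ((1 - 1 / (2 : ℕ)) * ∏ p ∈ S, (1 - 1 / (p : ℝ))) := by push_cast; ring

/-! ### The `Ω = 2` cell has `O(X/log Y)` elements -/

/-- For `e ≤ Y ≤ X` with `log X ≤ 3 log Y`: `#{b ∈ roughIcc ⌈Y⌉ ⌊X⌋ : Ω b = 2} ≤ C X/log Y`
(Alladi's asymptotic `exists_abs_roughCell_sub_main_le` with `I₂(u) ≤ u ≤ 3`). -/
theorem exists_card_cellTwo_le : ∃ C : ℝ, 0 ≤ C ∧ ∀ X Y : ℝ, Real.exp 1 ≤ Y → Y ≤ X →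
    Real.log X ≤ 3 * Real.log Y →
      (#((roughIcc ⌈Y⌉₊ ⌊X⌋₊).filter (fun b => ArithmeticFunction.cardFactors b = 2)) : ℝ) ≤
        C * X / Real.log Y := by
  obtain ⟨CA, hCA, hAl⟩ := exists_abs_roughCell_sub_main_le 1 3
  refine ⟨3 + CA, by positivity, fun X Y hY hYX hlog => ?_⟩
  have he : (2 : ℝ) < Real.exp 1 := by have := Real.exp_one_gt_d9; linarith
  have hY2 : 2 ≤ Y := by linarith
  have hY0 : 0 < Y := by linarith
  have hX0 : 0 < X := by linarith
  have hlogY : 1 ≤ Real.log Y := by rw [Real.le_log_iff_exp_le hY0]; exact hY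
  have hlogYpos : 0 < Real.log Y := by linarith
  have hlogX : Real.log Y ≤ Real.log X := Real.log_le_log hY0 hYX
  have hlogXpos : 0 < Real.log X := by linarith
  have h := hAl X Y hY2 hYX (by push_cast; exact hlog)
  simp only [show (1 : ℕ) ≠ 0 from one_ne_zero, if_false, sub_zero] at h
  have hup := (abs_le.1 h).2
  set u : ℝ := Real.log X / Real.log Y with hu
  have hu1 : 1 ≤ u := by rw [hu, le_div_iff₀ hlogYpos, one_mul]; exact hlogX
  have hu3 : u ≤ 3 := by rw [hu, div_le_iff₀ hlogYpos]; exact hlog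
  have hρ : roughCellDensity (1 + 1) u ≤ 3 := (roughCellDensity_le (by norm_num) hu1).trans hu3
  have hρ0 : 0 ≤ roughCellDensity (1 + 1) u := roughCellDensity_nonneg _ _
  have h1 : X * roughCellDensity (1 + 1) u / Real.log X ≤ 3 * X / Real.log Y := by
    calc X * roughCellDensity (1 + 1) u / Real.log X ≤ X * 3 / Real.log X :=
          div_le_div_of_nonneg_right (mul_le_mul_of_nonneg_left hρ hX0.le) hlogXpos.le
      _ ≤ X * 3 / Real.log Y := div_le_div_of_nonneg_left (by positivity) hlogYpos hlogX
      _ = 3 * X / Real.log Y := by ring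
  have h2 : CA * X / Real.log Y ^ 2 ≤ CA * X / Real.log Y := by
    rw [pow_two]
    calc CA * X / (Real.log Y * Real.log Y) = (CA * X / Real.log Y) / Real.log Y := by
          rw [div_div]
      _ ≤ CA * X / Real.log Y := div_le_self (by positivity) hlogY
  have e : (3 + CA) * X / Real.log Y = 3 * X / Real.log Y + CA * X / Real.log Y := by ring
  show (#((roughIcc ⌈Y⌉₊ ⌊X⌋₊).filter (fun b => ArithmeticFunction.cardFactors b = 1 + 1)) : ℝ) ≤ _
  rw [e]
  linarith

/-! ### Mertens' second theorem in a window, two-sided rate -/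

/-- `Σ_{A < p ≤ B} 1/p ≤ log log B − log log A + 8/log A + 8/log B` for `2 ≤ A ≤ B`
(from `|Σ_{p≤t} 1/p − log log t − B₁| ≤ 8/log t`). -/
theorem sum_inv_primes_window_le {A B : ℝ} (hA : 2 ≤ A) (hAB : A ≤ B) :
    ∑ p ∈ (Nat.primesLE ⌊B⌋₊).filter (fun p : ℕ => A < (p : ℝ)), (p : ℝ)⁻¹ ≤
      Real.log (Real.log B) - Real.log (Real.log A) + 8 / Real.log A + 8 / Real.log B := by
  have hB : 2 ≤ B := hA.trans hAB
  have h1 := (abs_le.1 (Mertens.abs_primeRecipSum_sub_le hA)).1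
  have h2 := (abs_le.1 (Mertens.abs_primeRecipSum_sub_le hB)).2
  have hsplit : ∑ p ∈ (Nat.primesLE ⌊B⌋₊).filter (fun p : ℕ => A < (p : ℝ)), (p : ℝ)⁻¹ =
      Mertens.primeRecipSum B - Mertens.primeRecipSum A := by
    rw [Mertens.primeRecipSum, Mertens.primeRecipSum]
    have hsub : Nat.primesLE ⌊A⌋₊ ⊆ Nat.primesLE ⌊B⌋₊ := by
      intro p hp
      rw [Nat.mem_primesLE] at hp ⊢
      exact ⟨hp.1.trans (Nat.floor_le_floor hAB), hp.2⟩
    rw [← Finset.sum_sdiff hsub, add_sub_cancel_right]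
    refine Finset.sum_congr ?_ fun _ _ => rfl
    ext p
    simp only [Finset.mem_sdiff, Finset.mem_filter, Nat.mem_primesLE]
    constructor
    · rintro ⟨⟨hpB, hp⟩, hAp⟩
      refine ⟨⟨hpB, hp⟩, fun h => ?_⟩
      have := (Nat.floor_lt (by linarith : (0 : ℝ) ≤ A)).2 hAp
      omega
    · rintro ⟨⟨hpB, hp⟩, h⟩
      refine ⟨⟨hpB, hp⟩, ?_⟩
      have : ¬ p ≤ ⌊A⌋₊ := fun hle => h ⟨hle, hp⟩
      rw [not_le] at this
      exact (Nat.floor_lt (by linarith)).1 this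
  rw [hsplit]
  linarith

/-- `Σ_{A < p ≤ B} 1/p ≤ (log B − log A + 16)/log A` for `2 ≤ A ≤ B`
(`log log B − log log A = log(1 + (log B − log A)/log A) ≤ (log B − log A)/log A`). -/
theorem sum_inv_primes_window_le' {A B : ℝ} (hA : 2 ≤ A) (hAB : A ≤ B) :
    ∑ p ∈ (Nat.primesLE ⌊B⌋₊).filter (fun p : ℕ => A < (p : ℝ)), (p : ℝ)⁻¹ ≤
      (Real.log B - Real.log A + 16) / Real.log A := by
  have h := sum_inv_primes_window_le hA hAB
  have hlA : 0 < Real.log A := Real.log_pos (by linarith)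
  have hlB : Real.log A ≤ Real.log B := Real.log_le_log (by linarith) hAB
  have hlB0 : 0 < Real.log B := by linarith
  have h1 : Real.log (Real.log B) - Real.log (Real.log A) ≤ (Real.log B - Real.log A) / Real.log A := by
    rw [← Real.log_div hlB0.ne' hlA.ne']
    have := Real.log_le_sub_one_of_pos (show 0 < Real.log B / Real.log A by positivity)
    have e : Real.log B / Real.log A - 1 = (Real.log B - Real.log A) / Real.log A := by
      field_simp
    linarith
  have h2 : 8 / Real.log B ≤ 8 / Real.log A := div_le_div_of_nonneg_left (by norm_num) hlA hlB
  have e : (Real.log B - Real.log A + 16) / Real.log A =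
      (Real.log B - Real.log A) / Real.log A + 8 / Real.log A + 8 / Real.log A := by
    field_simp; ring
  rw [e]; linarith

/-! ### The sum of `1/d` over the corner divisors -/

/-- A squarefree-free description: `Ω d = 2` and `q = minFac d` give `d = q·(d/q)` with `d/q` prime,
`q ≤ d/q`. -/
theorem div_minFac_prime_of_two {d : ℕ} (hΩ : Ω d = 2) :
    (d / d.minFac).Prime ∧ d.minFac ≤ d / d.minFac ∧ d.minFac * (d / d.minFac) = d := by
  have hd0 : d ≠ 0 := by rintro rfl; simp at hΩ
  have hd1 : d ≠ 1 := by rintro rfl; simp at hΩ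
  have hq : d.minFac.Prime := Nat.minFac_prime hd1
  have hdvd := Nat.minFac_dvd d
  have e := Nat.mul_div_cancel' hdvd
  have hk0 : d / d.minFac ≠ 0 := by
    intro h; rw [h, mul_zero] at e; exact hd0 e.symm
  have hΩk : Ω (d / d.minFac) = 1 := by
    have := ArithmeticFunction.cardFactors_mul hq.ne_zero hk0
    rw [e, hΩ, ArithmeticFunction.cardFactors_apply_prime hq] at this; omega
  have hkp : (d / d.minFac).Prime := ArithmeticFunction.cardFactors_eq_one_iff_prime.1 hΩk
  refine ⟨hkp, ?_, e⟩
  exact Nat.minFac_le_of_dvd hkp.two_le ⟨d.minFac, by rw [mul_comm]; exact e.symm⟩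

/-- **The corner divisors have small harmonic sum.** There is an absolute `C` such that for
`0 < ε ≤ 1/50` and `x ≥ x₀(ε)`: the semiprime `x^{1/5}`-rough integers `d` with `x^{1/2−2ε} < d`
and `d² ≤ 2x + 2` satisfy `Σ 1/d ≤ C·(ε + 1/log x)`.  (`d = q q'`, `q = P⁻(d) ∈ [x^{1/5}, (2x+2)^{1/4}]`,
`q' ∈ (x^{1/2−2ε}/q, √(2x+2)/q]`: Mertens in the two windows.) -/
theorem exists_sum_inv_cornerDivisors_le : ∃ C : ℝ, 0 < C ∧ ∀ ε : ℝ, 0 < ε → ε ≤ 1 / 50 →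
    ∃ x₀ : ℕ, ∀ x : ℕ, x₀ ≤ x →
      ∑ d ∈ (Finset.range (2 * x + 3)).filter (fun d : ℕ => ArithmeticFunction.cardFactors d = 2 ∧
          (∀ p ∈ d.primeFactors, (x : ℝ) ^ ((1 : ℝ) / 5) ≤ (p : ℝ)) ∧
          (x : ℝ) ^ ((1 : ℝ) / 2 - 2 * ε) < (d : ℝ) ∧ d * d ≤ 2 * x + 2), (1 : ℝ) / d ≤
        C * (ε + 1 / Real.log (x : ℝ)) := by
  refine ⟨26 * 85, by norm_num, fun ε hε hε50 => ?_⟩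
  -- `x` large: `log x ≥ 100`
  refine ⟨⌈Real.exp 100⌉₊, fun x hx => ?_⟩
  have hxE : Real.exp 100 ≤ (x : ℝ) := (Nat.le_ceil _).trans (by exact_mod_cast hx)
  have hx0 : (0 : ℝ) < x := (Real.exp_pos _).trans_le hxE
  have hx1 : (1 : ℝ) < x := lt_of_lt_of_le (by have := Real.add_one_le_exp (100 : ℝ); linarith) hxE
  set ℓ : ℝ := Real.log (x : ℝ) with hℓ
  have hℓ100 : 100 ≤ ℓ := by rw [hℓ, Real.le_log_iff_exp_le hx0]; exact hxE
  have hℓ0 : 0 < ℓ := by linarith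
  set y : ℝ := (x : ℝ) ^ ((1 : ℝ) / 5) with hy
  set D : ℝ := (x : ℝ) ^ ((1 : ℝ) / 2 - 2 * ε) with hD
  set E : ℝ := Real.sqrt (2 * (x : ℝ) + 2) with hE
  have hy0 : 0 < y := Real.rpow_pos_of_pos hx0 _
  have hD0 : 0 < D := Real.rpow_pos_of_pos hx0 _
  have hlogy : Real.log y = ℓ / 5 := by rw [hy, Real.log_rpow hx0]; ring
  have hlogD : Real.log D = (1 / 2 - 2 * ε) * ℓ := by rw [hD, Real.log_rpow hx0]
  have hE0 : 0 < E := Real.sqrt_pos.2 (by positivity)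
  have hEsq : E ^ 2 = 2 * (x : ℝ) + 2 := Real.sq_sqrt (by positivity)
  have le_sqrt_of_sq_le : ∀ a b : ℝ, 0 ≤ a → a ^ 2 ≤ b → a ≤ Real.sqrt b := fun a b ha h => by
    rw [← Real.sqrt_sq ha]; exact Real.sqrt_le_sqrt h
  have hlog4 : Real.log 4 ≤ 2 := by
    have := Real.log_two_lt_d9
    rw [show (4 : ℝ) = 2 ^ 2 by norm_num, Real.log_pow]; push_cast; linarith
  have hlogE : Real.log E ≤ (ℓ + 2) / 2 := by
    have h1 : Real.log (E ^ 2) = 2 * Real.log E := by rw [Real.log_pow]; push_cast; ring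
    have h2 : Real.log (2 * (x : ℝ) + 2) ≤ Real.log 4 + ℓ := by
      rw [hℓ, ← Real.log_mul (by norm_num) hx0.ne']
      exact Real.log_le_log (by positivity) (by linarith)
    rw [hEsq] at h1; linarith
  have hlogE' : ℓ / 2 ≤ Real.log E := by
    have h1 : Real.log (E ^ 2) = 2 * Real.log E := by rw [Real.log_pow]; push_cast; ring
    have h2 : ℓ ≤ Real.log (2 * (x : ℝ) + 2) := Real.log_le_log hx0 (by linarith)
    rw [hEsq] at h1; linarith
  -- the set and the fibres of `minFac`
  set 𝒟 := (Finset.range (2 * x + 3)).filter (fun d : ℕ => ArithmeticFunction.cardFactors d = 2 ∧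
      (∀ p ∈ d.primeFactors, y ≤ (p : ℝ)) ∧ D < (d : ℝ) ∧ d * d ≤ 2 * x + 2) with h𝒟
  set Q := (Finset.range (2 * x + 3)).filter Nat.Prime with hQ
  have hmaps : ∀ d ∈ 𝒟, d.minFac ∈ Q := by
    intro d hd
    rw [h𝒟, Finset.mem_filter, Finset.mem_range] at hd
    have hd1 : d ≠ 1 := by rintro rfl; simp at hd
    have hd0 : d ≠ 0 := by rintro rfl; simp at hd
    rw [hQ, Finset.mem_filter, Finset.mem_range]
    exact ⟨lt_of_le_of_lt (Nat.minFac_le (Nat.pos_of_ne_zero hd0)) hd.1, Nat.minFac_prime hd1⟩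
  rw [← Finset.sum_fiberwise_of_maps_to hmaps]
  -- facts about a member `d` with `minFac d = q`
  have hmem : ∀ d ∈ 𝒟, ∀ q : ℕ, d.minFac = q →
      (d / q).Prime ∧ y ≤ (q : ℝ) ∧ (q : ℝ) ≤ Real.sqrt E ∧ D / q < ((d / q : ℕ) : ℝ) ∧
        ((d / q : ℕ) : ℝ) ≤ E / q ∧ q * (d / q) = d ∧ (0 : ℝ) < q := by
    intro d hd q hq
    rw [h𝒟, Finset.mem_filter] at hd
    obtain ⟨-, hΩ, hr, hDd, hdd⟩ := hd
    obtain ⟨hkp, hqk, e⟩ := div_minFac_prime_of_two hΩ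
    rw [hq] at hkp hqk e
    have hd0 : d ≠ 0 := by rintro rfl; simp at hΩ
    have hqp : q.Prime := by rw [← hq]; exact Nat.minFac_prime (by rintro rfl; simp at hΩ)
    have hq0 : (0 : ℝ) < q := by exact_mod_cast hqp.pos
    have hyq : y ≤ (q : ℝ) := hr q (Nat.mem_primeFactors.2 ⟨hqp, ⟨d / q, e.symm⟩, hd0⟩)
    have hdE : (d : ℝ) ≤ E := by
      rw [hE]
      refine le_sqrt_of_sq_le _ _ (Nat.cast_nonneg d) ?_
      exact_mod_cast (by rw [pow_two]; exact hdd : d ^ 2 ≤ 2 * x + 2)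
    have hcast : (q : ℝ) * ((d / q : ℕ) : ℝ) = d := by exact_mod_cast e
    have hqE : (q : ℝ) ≤ Real.sqrt E := by
      refine le_sqrt_of_sq_le _ _ hq0.le ?_
      have : (q : ℝ) * q ≤ (q : ℝ) * ((d / q : ℕ) : ℝ) :=
        mul_le_mul_of_nonneg_left (by exact_mod_cast hqk) hq0.le
      rw [hcast] at this; nlinarith
    refine ⟨hkp, hyq, hqE, ?_, ?_, e, hq0⟩
    · rw [div_lt_iff₀ hq0, mul_comm, hcast]; exact hDd
    · rw [le_div_iff₀ hq0, mul_comm, hcast]; exact hdE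
  -- uniform bound for the inner window
  have hyE : y ≤ Real.sqrt E := by
    have hy4 : y ^ 4 = (x : ℝ) ^ ((4 : ℝ) / 5) := by
      rw [hy, ← Real.rpow_natCast, ← Real.rpow_mul hx0.le]; norm_num
    refine le_sqrt_of_sq_le _ _ hy0.le ?_
    rw [hE]
    refine le_sqrt_of_sq_le _ _ (by positivity) ?_
    rw [← pow_mul, show 2 * 2 = 4 by norm_num, hy4]
    calc (x : ℝ) ^ ((4 : ℝ) / 5) ≤ (x : ℝ) ^ (1 : ℝ) := Real.rpow_le_rpow_of_exponent_le hx1.le (by norm_num)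
      _ = x := Real.rpow_one _
      _ ≤ 2 * x + 2 := by linarith
  have hinner : ∀ q : ℕ, y ≤ (q : ℝ) → (q : ℝ) ≤ Real.sqrt E →
      ∑ p ∈ (Nat.primesLE ⌊E / q⌋₊).filter (fun p : ℕ => D / q < (p : ℝ)), (p : ℝ)⁻¹ ≤
        10 * ε + 85 / ℓ := by
    intro q hyq hqE
    have hq0 : (0 : ℝ) < q := lt_of_lt_of_le hy0 hyq
    have hlogq : Real.log q ≤ Real.log E / 2 := by
      have h1 : Real.log q ≤ Real.log (Real.sqrt E) := Real.log_le_log hq0 hqE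
      rw [Real.log_sqrt hE0.le] at h1; exact h1
    have hlA : Real.log (D / q) = Real.log D - Real.log q := Real.log_div hD0.ne' hq0.ne'
    have hlB : Real.log (E / q) = Real.log E - Real.log q := Real.log_div hE0.ne' hq0.ne'
    have hlA' : ℓ / 5 ≤ Real.log (D / q) := by
      rw [hlA, hlogD]; nlinarith
    have hA2 : 2 ≤ D / q := by
      have h1 : Real.log 2 ≤ Real.log (D / q) := by
        have := Real.log_two_lt_d9; linarith
      exact (Real.log_le_log_iff (by norm_num) (by positivity)).1 h1
    have hAB : D / q ≤ E / q := by
      refine div_le_div_of_nonneg_right ?_ hq0.le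
      have h1 : Real.log D ≤ Real.log E := by rw [hlogD]; nlinarith
      exact (Real.log_le_log_iff hD0 hE0).1 h1
    refine (sum_inv_primes_window_le' hA2 hAB).trans ?_
    rw [hlB, hlA, div_le_iff₀ (by linarith)]
    have hnum : Real.log E - Real.log q - (Real.log D - Real.log q) + 16 ≤ 2 * ε * ℓ + 17 := by
      rw [hlogD]; linarith
    have hden : 0 < Real.log D - Real.log q := by linarith
    calc Real.log E - Real.log q - (Real.log D - Real.log q) + 16 ≤ 2 * ε * ℓ + 17 := hnum
      _ = (10 * ε + 85 / ℓ) * (ℓ / 5) := by field_simp; ring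
      _ ≤ (10 * ε + 85 / ℓ) * (Real.log D - Real.log q) :=
          mul_le_mul_of_nonneg_left (by rw [← hlA]; exact hlA') (by positivity)
  -- the fibre sums
  have hfib : ∀ q ∈ Q, ∑ d ∈ 𝒟.filter (fun d => d.minFac = q), (1 : ℝ) / d ≤
      if y ≤ (q : ℝ) ∧ (q : ℝ) ≤ Real.sqrt E then (1 / (q : ℝ)) * (10 * ε + 85 / ℓ) else (0 : ℝ) := by
    intro q hq
    split_ifs with hcond
    · obtain ⟨hyq, hqE⟩ := hcond
      have hq0 : (0 : ℝ) < q := lt_of_lt_of_le hy0 hyq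
      have hqpos : 0 < q := by exact_mod_cast hq0
      calc ∑ d ∈ 𝒟.filter (fun d => d.minFac = q), (1 : ℝ) / d
          ≤ ∑ p ∈ (Nat.primesLE ⌊E / q⌋₊).filter (fun p : ℕ => D / q < (p : ℝ)),
              (1 / (q : ℝ)) * (p : ℝ)⁻¹ := by
            refine sum_le_sum_of_injOn_nonneg _ _ _ _ (fun d => d / q) ?_ ?_ ?_ ?_
            · intro d hd
              rw [Finset.mem_filter] at hd
              obtain ⟨hkp, -, -, hDk, hkE, e, -⟩ := hmem d hd.1 q hd.2
              rw [Finset.mem_filter, Nat.mem_primesLE]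
              refine ⟨⟨Nat.le_floor hkE, hkp⟩, hDk⟩
            · intro d₁ hd₁ d₂ hd₂ h
              rw [Finset.mem_coe, Finset.mem_filter] at hd₁ hd₂
              obtain ⟨-, -, -, -, -, e₁, -⟩ := hmem d₁ hd₁.1 q hd₁.2
              obtain ⟨-, -, -, -, -, e₂, -⟩ := hmem d₂ hd₂.1 q hd₂.2
              simp only at h
              rw [← e₁, ← e₂, h]
            · intro d hd
              rw [Finset.mem_filter] at hd
              obtain ⟨-, -, -, -, -, e, -⟩ := hmem d hd.1 q hd.2
              have hcast : (d : ℝ) = (q : ℝ) * ((d / q : ℕ) : ℝ) := by exact_mod_cast e.symm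
              rw [hcast, one_div, mul_inv, one_div]
            · intro p _; positivity
        _ = (1 / (q : ℝ)) * ∑ p ∈ (Nat.primesLE ⌊E / q⌋₊).filter (fun p : ℕ => D / q < (p : ℝ)),
              (p : ℝ)⁻¹ := by rw [Finset.mul_sum]
        _ ≤ (1 / (q : ℝ)) * (10 * ε + 85 / ℓ) :=
            mul_le_mul_of_nonneg_left (hinner q hyq hqE) (by positivity)
    · have hempty : 𝒟.filter (fun d => d.minFac = q) = ∅ := by
        rw [Finset.filter_eq_empty_iff]
        intro d hd hdq
        obtain ⟨-, hyq, hqE, -⟩ := hmem d hd q hdq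
        exact hcond ⟨hyq, hqE⟩
      rw [hempty, Finset.sum_empty]
  refine (Finset.sum_le_sum hfib).trans ?_
  rw [← Finset.sum_filter]
  -- the outer window by Mertens (upper half)
  have houter : ∑ q ∈ Q.filter (fun q : ℕ => y ≤ (q : ℝ) ∧ (q : ℝ) ≤ Real.sqrt E), (1 / (q : ℝ)) ≤ 26 := by
    have hsub : Q.filter (fun q : ℕ => y ≤ (q : ℝ) ∧ (q : ℝ) ≤ Real.sqrt E) ⊆
        (Nat.primesLE ⌊Real.sqrt E⌋₊).filter (fun p : ℕ => y ≤ (p : ℝ)) := by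
      intro q hq
      rw [Finset.mem_filter, hQ, Finset.mem_filter] at hq
      rw [Finset.mem_filter, Nat.mem_primesLE]
      exact ⟨⟨Nat.le_floor hq.2.2, hq.1.2⟩, hq.2.1⟩
    have hy1 : 1 < y := by rw [hy]; exact Real.one_lt_rpow hx1 (by norm_num)
    have h := RoughSums.sum_primesGe_inv_le hy1 hyE
    have hlogsE : Real.log (Real.sqrt E) ≤ (ℓ + 2) / 4 := by
      rw [Real.log_sqrt hE0.le]; linarith
    have hratio : Real.log (Real.log (Real.sqrt E) / Real.log y) ≤ 1 := by
      have hpos : 0 < Real.log (Real.sqrt E) := by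
        have := Real.log_le_log hy0 hyE
        have : 0 < Real.log y := by rw [hlogy]; positivity
        linarith
      have h1 : Real.log (Real.sqrt E) / Real.log y ≤ 2 := by
        rw [hlogy, div_le_iff₀ (by positivity)]; linarith
      calc Real.log (Real.log (Real.sqrt E) / Real.log y) ≤ Real.log 2 :=
            Real.log_le_log (by rw [hlogy]; positivity) h1
        _ ≤ 1 := by have := Real.log_two_lt_d9; linarith
    calc ∑ q ∈ Q.filter (fun q : ℕ => y ≤ (q : ℝ) ∧ (q : ℝ) ≤ Real.sqrt E), (1 / (q : ℝ))
        ≤ ∑ p ∈ (Nat.primesLE ⌊Real.sqrt E⌋₊).filter (fun p : ℕ => y ≤ (p : ℝ)), (1 / (p : ℝ)) :=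
          Finset.sum_le_sum_of_subset_of_nonneg hsub fun _ _ _ => by positivity
      _ = ∑ p ∈ (Nat.primesLE ⌊Real.sqrt E⌋₊).filter (fun p : ℕ => y ≤ (p : ℝ)), (p : ℝ)⁻¹ := by
          simp only [one_div]
      _ ≤ 26 := by linarith
  have hw0 : 0 ≤ 10 * ε + 85 / ℓ := by positivity
  calc ∑ q ∈ Q.filter (fun q : ℕ => y ≤ (q : ℝ) ∧ (q : ℝ) ≤ Real.sqrt E), 1 / (q : ℝ) * (10 * ε + 85 / ℓ)
      = (∑ q ∈ Q.filter (fun q : ℕ => y ≤ (q : ℝ) ∧ (q : ℝ) ≤ Real.sqrt E), 1 / (q : ℝ)) *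
          (10 * ε + 85 / ℓ) := by rw [Finset.sum_mul]
    _ ≤ 26 * (10 * ε + 85 / ℓ) := mul_le_mul_of_nonneg_right houter hw0
    _ ≤ 26 * 85 * (ε + 1 / ℓ) := by
        have h0 : 0 ≤ 1 / ℓ := by positivity
        have e1 : 26 * (10 * ε + 85 / ℓ) = 260 * ε + 2210 * (1 / ℓ) := by ring
        have e2 : 26 * 85 * (ε + 1 / ℓ) = 2210 * ε + 2210 * (1 / ℓ) := by ring
        rw [e1, e2]; linarith

end Summit.Parity.GeneralizedHardyLittlewood.Theorems.ParityLeakOneFifth
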